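import Literature.AnabelianGeometry.SemiGraphs.PSCSmoothCurveShape
import Literature.AnabelianGeometry.SemiGraphs.PSCSeparatingCoveringsSmoothProper
import Literature.AnabelianGeometry.SemiGraphs.ProSigmaCompletionRestrict
import Literature.AnabelianGeometry.SemiGraphs.ProSigmaCompletionInjective
import Literature.AnabelianGeometry.SemiGraphs.SurfaceTypeCoveringsToolkit
import Literature.GroupTheory.CombinatorialGroupTheory.PuncturedSurfaceGroupFiniteIndexSubgroupHolds
import Literature.GroupTheory.CombinatorialGroupTheory.PuncturedSurfaceGroupMixedCuspQuotients
import Literature.GroupTheory.CombinatorialGroupTheory.PuncturedSurfaceGroupFree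
import HarnessLib

/-!
# [CombGC] Prop. 1.2, proof p. 9: EDGE-LIKE separating coverings at genuine smooth-curve data (rows F-2827, F-2829, F-2830)

Mochizuki, *A combinatorial version of the Grothendieck conjecture*, Tohoku Math. J. **59** (2007)
[CombGC], PROOF of Proposition 1.2, author's manuscript p. 9, the resp'd (edge) case: "if … `e₁ ≠ e₂`,
then there exists a finite étale … `Π_G`-covering `G' → G` whose restriction to the anabelioid `G_{e₂}`
is trivial …, but whose restriction to the anabelioid `G_{e₁}` is nontrivial.  But … by gluing together
appropriate finite étale coverings of the anabelioids `G_v`, `G_e`, one may construct a finite étale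
covering `G' → G` with the desired properties" [cite: MochizukiCombGC2007, Prop 1.2 proof p.9].  Typed
LEVEL-WISE by abc-iut-w4-d081 as `PSCDatum.EdgeLikeSeparatingCoverings` (abc-iut FACT-LIST row F-2827), the
edge-like conjunct of `SeparatingCoverings` (F-2829) / `SeparatingCoveringsHolds Ω` (F-2830)
(`PSCSeparatingCoverings.lean`, sub-DAG row P12-L01; universal closures refuted in
`PSCSeparatingCoveringsNegative.lean`; the edgeless smooth-proper instance of
`PSCSeparatingCoveringsSmoothProper.lean` is vacuous in the pair quantifier; the verticial conjuncts are
derived from [IUTchI] Rmk. 1.2.3 (iv) inputs in `PSCSeparatingCoveringsOfVertexQuotients.lean` /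
`…UnrOfVertexQuotients.lean`, inputs which FAIL at one-vertex data —
`PSCUnrVerticialOneVertex.not_unrVerticialCharacterizationHolds_of_oneVertex`).  PROOF-ONLY file: the edge
case at the GENUINE data of `PSCSmoothCurveShape.lean` (one vertex with `Π_v = Π`, no nodes, `r` cusps whose
groups are the closed cusp inertia groups `closure ι⟨c_i⟩` of a pro-`Σ` completion `ι : Γ_{g,r} → Π` of a
hyperbolic punctured surface group, `Π` profinite), where for `r ≥ 2` there ARE cusps to separate:

* `exists_edgeSeparating_of_smoothCurve` — the separating covering at every open normal level `V`: two
  distinct level-`V` cusps `(c₁, Vγ₁Π_{c₁}) ≠ (c₂, Vγ₂Π_{c₂})` admit an open `U ≤ V`, normal in `V`, with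
  `γ₂Π_{c₂}γ₂⁻¹ ∩ V ⊆ U`, `γ₁Π_{c₁}γ₁⁻¹ ∩ V ⊄ U`.  Print's "gluing" is, for a smooth curve, group theory
  over tree THEOREMS: the level `ι⁻¹(V)` is a `Γ_{g',r'}` WITH ITS PERIPHERAL STRUCTURE (Riemann–Hurwitz,
  `puncturedSurfaceGroupFiniteIndexSubgroup_holds`), `V` is its pro-`Σ` completion
  (`IsProSigmaCompletion.restrict_comp_of_range_eq`), the two level cusps are cusps `j₁ ≠ j₂` of
  `Γ_{g',r'}`, and an `ℓ`-group quotient (`ℓ ∈ Σ`) killing `c_{j₂}`, ramified of index `ℓ` at `c_{j₁}`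
  (`PuncturedSurfaceGroup.exists_normal_mixed`; its genus-`0` obstruction is excluded by hyperbolicity of
  `(g', r')`) extends to `U`;
* `edgeLikeSeparatingCoverings_of_smoothCurve` (**F-2827**, `V' := V`), the un-conjugated special case
  `exists_open_separating_cusps_of_smoothCurve`, `separatingCoverings_of_smoothCurve` (**F-2829**),
  `separatingCoveringsHolds_of_smoothCurve` (**F-2830** at every origin of smooth-curve data; the
  inhabited origin with an explicitly separated pair of cusps of the tripod is in the companion
  `PSCSeparatingCoveringsSmoothCurveOrigin.lean`).

Instance forms at genuine anabelian data; not the printed statement for multi-component pointed stable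
curves (cell FOUNDATIONS rows 13–14).  0 definitions; nothing here takes a side on [IUTchIII] Cor. 3.12.
-/

noncomputable section

namespace Literature.AnabelianGeometry.SemiGraphs

namespace PSCDatum

open scoped Pointwise
open Literature.AnabelianGeometry.Anabelioids (IsSigmaInteger)
open Literature.GroupTheory.CombinatorialGroupTheory
open Literature.GroupTheory.CombinatorialGroupTheory.PuncturedSurfaceGroup (c cuspInertia IsHyperbolicType
  peripheralSubgroup)
open SemiGraphOfAnabelioids (IsProSigmaCompletion)
open SemiGraphOfAnabelioids.IsProSigmaCompletion (restrict_comp_of_range_eq isOpen_map_subtype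
  normal_of_comap_normal finiteIndex_comap exists_mem_coset isSigmaInteger_prime_pow
  not_isOfFinOrder_of_isFreeGroup)

universe u

variable {P : Type u} [Group P] [TopologicalSpace P] [IsTopologicalGroup P]

/-! ### Bookkeeping: conjugates, images, the peripheral subgroup seen from a level -/

omit [TopologicalSpace P] [IsTopologicalGroup P] in
/-- `f (a H a⁻¹) = f(a) f(H) f(a)⁻¹`. [folklore] -/
private theorem map_toConjAct_smul {Γ : Type*} [Group Γ] (f : Γ →* P) (a : Γ) (H : Subgroup Γ) :
    (ConjAct.toConjAct a • H).map f = ConjAct.toConjAct (f a) • H.map f := by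
  rw [← map_conj_eq_conjAct_smul, ← map_conj_eq_conjAct_smul, Subgroup.map_map, Subgroup.map_map]
  congr 1
  ext x
  simp [MulAut.conj_apply]

omit [TopologicalSpace P] [IsTopologicalGroup P] in
/-- The image in `Π` of a subgroup `U'` normal in `V` is stable under conjugation by `V`. [folklore] -/
private theorem conjAct_smul_map_subtype_of_mem {V : Subgroup P} (U' : Subgroup V) [hU : U'.Normal]
    {t : P} (ht : t ∈ V) : ConjAct.toConjAct t • U'.map V.subtype = U'.map V.subtype := by
  ext x
  rw [Subgroup.mem_pointwise_smul_iff_inv_smul_mem, ← map_inv, ConjAct.smul_def,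
    ConjAct.ofConjAct_toConjAct, inv_inv]
  constructor
  · intro hx
    obtain ⟨u, hu, hux⟩ := Subgroup.mem_map.mp hx
    refine Subgroup.mem_map.mpr ⟨⟨t, ht⟩ * u * ⟨t, ht⟩⁻¹, hU.conj_mem u hu ⟨t, ht⟩, ?_⟩
    have hux' : (u : P) = t⁻¹ * x * t := hux
    change ((⟨t, ht⟩ * u * ⟨t, ht⟩⁻¹ : V) : P) = x
    rw [Subgroup.coe_mul, Subgroup.coe_mul, Subgroup.coe_inv, hux']
    group
  · intro hx
    obtain ⟨u, hu, rfl⟩ := Subgroup.mem_map.mp hx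
    refine Subgroup.mem_map.mpr ⟨⟨t, ht⟩⁻¹ * u * ⟨t, ht⟩⁻¹⁻¹, hU.conj_mem u hu ⟨t, ht⟩⁻¹, ?_⟩
    change ((⟨t, ht⟩⁻¹ * u * ⟨t, ht⟩⁻¹⁻¹ : V) : P) = t⁻¹ * (u : P) * t
    rw [inv_inv, Subgroup.coe_mul, Subgroup.coe_mul, Subgroup.coe_inv]

omit [TopologicalSpace P] [IsTopologicalGroup P] in
/-- For `U'` normal in `V` and `t ∈ V`: `t B t⁻¹ ⊆ U'` iff `B ⊆ U'` ("trivial over a cusp" does not depend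
on the representative of the cusp, nor on `V`-conjugation). [cite: MochizukiCombGC2007, Def 1.1(ii) p.6] -/
private theorem conjAct_smul_le_iff {V : Subgroup P} (U' : Subgroup V) [U'.Normal] {t : P} (ht : t ∈ V)
    (B : Subgroup P) : ConjAct.toConjAct t • B ≤ U'.map V.subtype ↔ B ≤ U'.map V.subtype := by
  conv_lhs => rw [← conjAct_smul_map_subtype_of_mem U' ht]
  exact Subgroup.pointwise_smul_le_pointwise_smul_iff

omit [TopologicalSpace P] [IsTopologicalGroup P] in
/-- The peripheral subgroup `K ∩ γ⟨c_j⟩γ⁻¹` only depends on the double coset `Kγ⟨c_j⟩`, up to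
`K`-conjugacy: `K ∩ f⟨c_j⟩f⁻¹ = k⁻¹ (K ∩ (kfz)⟨c_j⟩(kfz)⁻¹) k` for `k ∈ K`, `z ∈ ⟨c_j⟩`.
[cite: ZieschangVogtColdewey1980, Thm 4.14.1 p.150] -/
private theorem peripheralSubgroup_eq_of_rep {g r : ℕ} (K : Subgroup (PuncturedSurfaceGroup g r))
    (j : Fin r) {k f z : PuncturedSurfaceGroup g r} (hk : k ∈ K) (hz : z ∈ cuspInertia (g := g) j) :
    peripheralSubgroup K j f = ConjAct.toConjAct k⁻¹ • peripheralSubgroup K j (k * f * z) := by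
  unfold peripheralSubgroup
  rw [map_conj_eq_conjAct_smul, map_conj_eq_conjAct_smul, inf_conjAct_smul_mul_mul K _ hk hz, ← mul_smul,
    ← map_mul, inv_mul_cancel, map_one, one_smul]

/-- In a hyperbolic punctured surface group a cusp generator `c_j` does not lie in a subgroup `N` meeting
`⟨c_j⟩` in `⟨c_j ^ ℓ⟩`, `ℓ` prime (`c_j` has infinite order: `Γ_{g,r}`, `r ≥ 1`, is free and `c_j ≠ 1`).
[cite: MochizukiSemiAnbd2006, Ex. 2.10 p.31] -/
private theorem c_not_mem_of_inf_cuspInertia_eq {g r : ℕ} (h : IsHyperbolicType g r) {ℓ : ℕ}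
    (hℓ : ℓ.Prime) (j : Fin r) (N : Subgroup (PuncturedSurfaceGroup g r))
    (hN : N ⊓ cuspInertia (g := g) j = Subgroup.zpowers (c (g := g) j ^ ℓ)) : c (g := g) j ∉ N := by
  intro hmem
  have hmem' : c (g := g) j ∈ N ⊓ cuspInertia (g := g) j :=
    Subgroup.mem_inf.mpr ⟨hmem, Subgroup.mem_zpowers _⟩
  rw [hN, Subgroup.mem_zpowers_iff] at hmem'
  obtain ⟨m, hm⟩ := hmem'
  obtain ⟨r', rfl⟩ : ∃ r', r = r' + 1 := ⟨r - 1, by have := j.2; omega⟩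
  obtain ⟨eF⟩ := PuncturedSurfaceGroup.nonempty_mulEquiv_freeGroup g r'
  haveI : IsFreeGroup (PuncturedSurfaceGroup g (r' + 1)) := IsFreeGroup.ofMulEquiv eF.symm
  refine not_isOfFinOrder_of_isFreeGroup (PuncturedSurfaceGroup.c_ne_one h j) ?_
  rw [isOfFinOrder_iff_zpow_eq_one]
  refine ⟨ℓ * m - 1, fun h0 => ?_, ?_⟩
  · have h1 : (ℓ : ℤ) ∣ 1 := ⟨m, by omega⟩
    have h2 : (ℓ : ℤ) = 1 := Int.eq_one_of_dvd_one (by exact_mod_cast hℓ.pos.le) h1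
    exact hℓ.ne_one (by exact_mod_cast h2)
  · rw [zpow_sub_one, zpow_mul, zpow_natCast, hm, mul_inv_cancel]

/-- **The cusps of the level-`V` covering seen in `Π`.**  For `ι : Γ_{g,r} → Π`, a datum whose cusp groups
are the closed cusp inertia groups `closure ι⟨c_{e c}⟩`, an open subgroup `V` and `f ∈ Γ_{g,r}`:
`f Π_c f⁻¹ ∩ V` is the closure of the image of the PERIPHERAL subgroup `ι⁻¹(V) ∩ f⟨c⟩f⁻¹` of the
finite-index level `ι⁻¹(V)` (the fundamental group of the corresponding cusp of the covering surface).
[cite: MochizukiCombGC2007, Def 1.1(ii) p.6] -/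
theorem conjAct_smul_cuspGp_inf_eq {g r : ℕ} (ι : PuncturedSurfaceGroup g r →* P) (G : PSCDatum P)
    (e : G.graph.C ≃ Fin r)
    (hC : ∀ c, G.cuspGp c = ((cuspInertia (g := g) (e c)).map ι).topologicalClosure)
    (V : Subgroup P) (hV : IsOpen (V : Set P)) (f : PuncturedSurfaceGroup g r) (c₀ : G.graph.C) :
    (ConjAct.toConjAct (ι f) • G.cuspGp c₀) ⊓ V =
      ((peripheralSubgroup (V.comap ι) (e c₀) f).map ι).topologicalClosure := by
  rw [hC c₀, ← topologicalClosure_conjAct_smul, ← map_toConjAct_smul,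
    topologicalClosure_map_inf_of_isOpen ι _ V hV]
  unfold peripheralSubgroup
  rw [map_conj_eq_conjAct_smul, inf_comm]

/-! ### The separating covering at a level of a smooth curve -/

section SmoothCurve

variable [CompactSpace P] [TotallyDisconnectedSpace P]
variable {Sigma : Set ℕ} {g r : ℕ}

/-- **[CombGC] Prop. 1.2, proof p. 9, edge case, AT A LEVEL of a smooth curve.**  Let `ι : Γ_{g,r} → Π` be a
pro-`Σ` completion of a hyperbolic punctured surface group (`Π` profinite), `G` a datum whose cusp groups
are the closed cusp inertia groups, `V ⊴ Π` open.  For two DISTINCT cusps `(c₁, Vγ₁Π_{c₁}) ≠ (c₂, Vγ₂Π_{c₂})`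
of the covering `G_V` there is an open `U ≤ V`, normal in `V` (a finite étale Galois covering of `G_V`),
with `γ₂Π_{c₂}γ₂⁻¹ ∩ V ⊆ U` ("trivial over the second cusp") and `γ₁Π_{c₁}γ₁⁻¹ ∩ V ⊄ U` ("nontrivial over
the first").  PROOF: `ι⁻¹(V) = θ(Γ_{g',r'})` with its cusps (`puncturedSurfaceGroupFiniteIndexSubgroup_holds`);
the two level cusps are cusps `j₁ ≠ j₂` of `Γ_{g',r'}`; `V` is the pro-`Σ` completion of `Γ_{g',r'}`
(`restrict_comp_of_range_eq`); the normal `ℓ`-power-index `N ⊴ Γ_{g',r'}` of `exists_normal_mixed` with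
`c_{j₂} ∈ N`, `N ∩ ⟨c_{j₁}⟩ = ⟨c_{j₁}^ℓ⟩` is the trace of the required open `U`.
[cite: MochizukiCombGC2007, Prop 1.2 proof p.9] -/
theorem exists_edgeSeparating_of_smoothCurve (hne : Sigma.Nonempty) (hprime : ∀ p ∈ Sigma, p.Prime)
    (h : IsHyperbolicType g r) (ι : PuncturedSurfaceGroup g r →* P) (hι : IsProSigmaCompletion Sigma ι)
    (G : PSCDatum P) (e : G.graph.C ≃ Fin r)
    (hC : ∀ c, G.cuspGp c = ((cuspInertia (g := g) (e c)).map ι).topologicalClosure)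
    (V : Subgroup P) [hVn : V.Normal] (hVo : IsOpen (V : Set P)) (c₁ c₂ : G.graph.C) (γ₁ γ₂ : ConjAct P)
    (hne12 : c₁ ≠ c₂ ∨
      DoubleCoset.doubleCoset (ConjAct.ofConjAct γ₁) (V : Set P) (G.cuspGp c₁ : Set P) ≠
        DoubleCoset.doubleCoset (ConjAct.ofConjAct γ₂) (V : Set P) (G.cuspGp c₂ : Set P)) :
    ∃ U : Subgroup P, IsOpen (U : Set P) ∧ U ≤ V ∧ (U.subgroupOf V).Normal ∧
      (γ₂ • G.cuspGp c₂) ⊓ V ≤ U ∧ ¬ ((γ₁ • G.cuspGp c₁) ⊓ V ≤ U) := by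
  classical
  -- (A) the discrete level `K = ι⁻¹(V)` is a punctured surface group with its peripheral structure
  set K : Subgroup (PuncturedSurfaceGroup g r) := V.comap ι with hK
  haveI : K.FiniteIndex := finiteIndex_comap hι V hVo
  obtain ⟨g', r', θ, cusp, rep, h', hθinj, hθr, -, hper, huniq⟩ :=
    puncturedSurfaceGroupFiniteIndexSubgroup_holds g r h K inferInstance
  -- (B) the representatives `γᵢ` may be taken in `ι(Γ)` (dense), up to `V`-conjugacy
  have stepB : ∀ (γ : ConjAct P) (c₀ : G.graph.C), ∃ (f : PuncturedSurfaceGroup g r) (w : P), w ∈ V ∧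
      (γ • G.cuspGp c₀) ⊓ V = ConjAct.toConjAct w • ((ConjAct.toConjAct (ι f) • G.cuspGp c₀) ⊓ V) ∧
      DoubleCoset.doubleCoset (ConjAct.ofConjAct γ) (V : Set P) (G.cuspGp c₀ : Set P) =
        DoubleCoset.doubleCoset (ι f) (V : Set P) (G.cuspGp c₀ : Set P) := by
    intro γ c₀
    obtain ⟨f, hf⟩ := exists_mem_coset hι V hVo (ConjAct.ofConjAct γ)
    have hw : ConjAct.ofConjAct γ * (ι f)⁻¹ ∈ V := by
      have h1 := hVn.conj_mem _ (V.inv_mem hf) (ConjAct.ofConjAct γ)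
      simpa [mul_assoc] using h1
    refine ⟨f, ConjAct.ofConjAct γ * (ι f)⁻¹, hw, ?_, ?_⟩
    · rw [Subgroup.smul_inf, conjAct_smul_eq_self_of_mem hw, ← mul_smul, ← map_mul,
        inv_mul_cancel_right, ConjAct.toConjAct_ofConjAct]
    · exact DoubleCoset.doubleCoset_eq_of_mem (DoubleCoset.mem_doubleCoset.mpr
        ⟨ConjAct.ofConjAct γ * (ι f)⁻¹, hw, 1, (G.cuspGp c₀).one_mem, by group⟩)
  obtain ⟨f₁, w₁, hw₁, hA₁, hdc₁⟩ := stepB γ₁ c₁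
  obtain ⟨f₂, w₂, hw₂, hA₂, hdc₂⟩ := stepB γ₂ c₂
  -- (D) the cusps `j₁`, `j₂` of `Γ_{g',r'}` that the two level cusps are
  obtain ⟨j₁, ⟨hcusp₁, k₁, hk₁, z₁, hz₁, hrep₁⟩, -⟩ := huniq (e c₁) f₁
  obtain ⟨j₂, ⟨hcusp₂, k₂, hk₂, z₂, hz₂, hrep₂⟩, -⟩ := huniq (e c₂) f₂
  have hB : ∀ {c₀ : G.graph.C} {f k z : PuncturedSurfaceGroup g r} {j : Fin r'}, cusp j = e c₀ → k ∈ K →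
      z ∈ cuspInertia (g := g) (e c₀) → rep j = k * f * z →
      (ConjAct.toConjAct (ι f) • G.cuspGp c₀) ⊓ V =
        ConjAct.toConjAct (ι k)⁻¹ • ((cuspInertia (g := g') j).map (ι.comp θ)).topologicalClosure := by
    intro c₀ f k z j hcj hk hz hrep
    rw [conjAct_smul_cuspGp_inf_eq ι G e hC V hVo f c₀, peripheralSubgroup_eq_of_rep K (e c₀) hk hz,
      ← hrep, ← hcj, ← hper j, map_toConjAct_smul, map_inv, topologicalClosure_conjAct_smul,
      Subgroup.map_map]
  have ht₁ : w₁ * (ι k₁)⁻¹ ∈ V := V.mul_mem hw₁ (V.inv_mem hk₁)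
  have ht₂ : w₂ * (ι k₂)⁻¹ ∈ V := V.mul_mem hw₂ (V.inv_mem hk₂)
  have hE₁ : (γ₁ • G.cuspGp c₁) ⊓ V =
      ConjAct.toConjAct (w₁ * (ι k₁)⁻¹) • ((cuspInertia (g := g') j₁).map (ι.comp θ)).topologicalClosure := by
    rw [hA₁, hB hcusp₁ hk₁ hz₁ hrep₁, ← mul_smul, ← map_mul]
  have hE₂ : (γ₂ • G.cuspGp c₂) ⊓ V =
      ConjAct.toConjAct (w₂ * (ι k₂)⁻¹) • ((cuspInertia (g := g') j₂).map (ι.comp θ)).topologicalClosure := by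
    rw [hA₂, hB hcusp₂ hk₂ hz₂ hrep₂, ← mul_smul, ← map_mul]
  -- distinct level cusps are distinct cusps of `Γ_{g',r'}`
  have hj : j₁ ≠ j₂ := by
    intro hj
    subst hj
    have hc : c₁ = c₂ := e.injective (hcusp₁.symm.trans hcusp₂)
    subst hc
    refine hne12.elim (fun hn => hn rfl) (fun hn => hn ?_)
    rw [hdc₁, hdc₂]
    symm
    refine DoubleCoset.doubleCoset_eq_of_mem (DoubleCoset.mem_doubleCoset.mpr
      ⟨ι (k₂⁻¹ * k₁), K.mul_mem (K.inv_mem hk₂) hk₁, ι (z₁ * z₂⁻¹), ?_, ?_⟩)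
    · rw [hC]
      exact Subgroup.le_topologicalClosure _
        (Subgroup.mem_map_of_mem ι ((cuspInertia _).mul_mem hz₁ ((cuspInertia _).inv_mem hz₂)))
    · rw [← map_mul, ← map_mul]
      congr 1
      have hrr : k₁ * f₁ * z₁ = k₂ * f₂ * z₂ := hrep₁.symm.trans hrep₂
      calc f₂ = k₂⁻¹ * (k₂ * f₂ * z₂) * z₂⁻¹ := by group
        _ = k₂⁻¹ * (k₁ * f₁ * z₁) * z₂⁻¹ := by rw [hrr]
        _ = k₂⁻¹ * k₁ * f₁ * (z₁ * z₂⁻¹) := by group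
  -- (E) the finite `ℓ`-quotient of `Γ_{g',r'}` killing `c_{j₂}` and ramified at `c_{j₁}`
  obtain ⟨ℓ, hℓS⟩ := hne
  have hℓ : ℓ.Prime := hprime ℓ hℓS
  have hobs : ¬ (g' = 0 ∧ ({j₁} : Finset (Fin r')).card = 1 ∧
      ({j₂} ∪ {j₁} : Finset (Fin r')) = Finset.univ) := by
    rintro ⟨hg0, -, huniv⟩
    have hcard : Fintype.card (Fin r') ≤ 2 := by
      rw [← Finset.card_univ, ← huniv]
      exact (Finset.card_union_le _ _).trans (by simp)
    rw [Fintype.card_fin] at hcard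
    unfold IsHyperbolicType at h'
    omega
  obtain ⟨N, hNn, hNidx, hZ, hR⟩ := PuncturedSurfaceGroup.exists_normal_mixed (g := g') hℓ.pos {j₂} {j₁}
    (Finset.disjoint_singleton_left.mpr (by rw [Finset.mem_singleton]; exact fun h0 => hj h0.symm)) hobs
  have hc₂N : c (g := g') j₂ ∈ N := hZ j₂ (Finset.mem_singleton_self _)
  have hc₁N : c (g := g') j₁ ∉ N :=
    c_not_mem_of_inf_cuspInertia_eq h' hℓ j₁ N (hR j₁ (Finset.mem_singleton_self _))
  -- (F) `V` is the pro-`Σ` completion of `Γ_{g',r'}`: `N` is the trace of an open `U' ⊴ V`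
  have hmem : ∀ x, ι (θ x) ∈ V := fun x => by
    have hx : θ x ∈ K := by rw [← hθr]; exact ⟨x, rfl⟩
    exact hx
  haveI := hNn
  have hι' : IsProSigmaCompletion Sigma ((ι.comp θ).codRestrict V hmem) :=
    restrict_comp_of_range_eq hι V hVo θ hθinj hθr hmem
  have hNS : IsSigmaInteger Sigma N.index := (isSigmaInteger_prime_pow hℓ hℓS 3).of_dvd hNidx
  obtain ⟨U', hU'o, hU'c⟩ := hι'.comap_surj N hNn hNS
  haveI hU'n : U'.Normal :=
    normal_of_comap_normal hι' U' hU'o (by rw [hU'c]; exact hNn)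
  have hcomp : V.subtype.comp ((ι.comp θ).codRestrict V hmem) = ι.comp θ := MonoidHom.ext fun _ => rfl
  have hUo : IsOpen ((U'.map V.subtype : Subgroup P) : Set P) := isOpen_map_subtype V hVo U' hU'o
  refine ⟨U'.map V.subtype, hUo, Subgroup.map_subtype_le U', ?_, ?_, ?_⟩
  · rw [← Subgroup.comap_subtype, Subgroup.comap_map_eq_self_of_injective V.subtype_injective]
    exact hU'n
  · -- trivial over the second cusp: `c_{j₂} ∈ N`
    rw [hE₂, conjAct_smul_le_iff U' ht₂]
    refine Subgroup.topologicalClosure_minimal _ ?_ (Subgroup.isClosed_of_isOpen _ hUo)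
    rw [← hcomp, ← Subgroup.map_map]
    refine Subgroup.map_mono (Subgroup.map_le_iff_le_comap.mpr ?_)
    rw [hU'c]
    exact (Subgroup.zpowers_le.mpr hc₂N : cuspInertia (g := g') j₂ ≤ N)
  · -- nontrivial over the first cusp: `c_{j₁} ∉ N`
    rw [hE₁, conjAct_smul_le_iff U' ht₁]
    intro hle
    apply hc₁N
    rw [← hU'c, Subgroup.mem_comap]
    have h1 : (ι.comp θ) (c (g := g') j₁) ∈ U'.map V.subtype :=
      hle (Subgroup.le_topologicalClosure _ (Subgroup.mem_map_of_mem _ (Subgroup.mem_zpowers _)))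
    obtain ⟨u, hu, huc⟩ := Subgroup.mem_map.mp h1
    have hu' : u = (ι.comp θ).codRestrict V hmem (c (g := g') j₁) := Subtype.ext huc
    rw [← hu']
    exact hu

/-- **Row F-2827 `EdgeLikeSeparatingCoverings` at genuine smooth-curve data** (one vertex, no nodes, cusp
groups the closed cusp inertia groups of a pro-`Σ` completion of a hyperbolic `Γ_{g,r}`; `Π` profinite):
for every open normal `V` the level `V' := V` itself separates any two distinct level cusps.  Non-vacuous
as soon as `r ≥ 2` (or `r = 1` at a level where the cusp splits). [cite: MochizukiCombGC2007, Prop 1.2 proof p.9] -/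
theorem edgeLikeSeparatingCoverings_of_smoothCurve (hne : Sigma.Nonempty) (hprime : ∀ p ∈ Sigma, p.Prime)
    (h : IsHyperbolicType g r) (ι : PuncturedSurfaceGroup g r →* P) (hι : IsProSigmaCompletion Sigma ι)
    (G : PSCDatum P) (e : G.graph.C ≃ Fin r)
    (hC : ∀ c, G.cuspGp c = ((cuspInertia (g := g) (e c)).map ι).topologicalClosure) [IsEmpty G.graph.N] :
    G.EdgeLikeSeparatingCoverings := by
  intro V hVn hVo
  haveI := hVn
  refine ⟨V, hVn, hVo, le_rfl, fun e₁ e₂ γ₁ γ₂ hne12 => ?_⟩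
  rcases e₁ with n | c₁
  · exact isEmptyElim n
  rcases e₂ with n | c₂
  · exact isEmptyElim n
  exact G.exists_edgeSeparating_of_smoothCurve hne hprime h ι hι e hC V hVo c₁ c₂ γ₁ γ₂
    (hne12.imp (fun hn hc => hn (by rw [hc])) id)

/-- **The un-conjugated special case, visibly non-vacuous**: at smooth-curve data with two distinct cusps
`c₁ ≠ c₂`, EVERY open normal `V ⊴ Π` has an open `U ≤ V`, normal in `V`, with `Π_{c₂} ∩ V ⊆ U` and
`Π_{c₁} ∩ V ⊄ U` — a finite étale Galois covering of `G_V` trivial over the cusp `V·1·Π_{c₂}` and nontrivial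
over `V·1·Π_{c₁}`. [cite: MochizukiCombGC2007, Prop 1.2 proof p.9] -/
theorem exists_open_separating_cusps_of_smoothCurve (hne : Sigma.Nonempty) (hprime : ∀ p ∈ Sigma, p.Prime)
    (h : IsHyperbolicType g r) (ι : PuncturedSurfaceGroup g r →* P) (hι : IsProSigmaCompletion Sigma ι)
    (G : PSCDatum P) (e : G.graph.C ≃ Fin r)
    (hC : ∀ c, G.cuspGp c = ((cuspInertia (g := g) (e c)).map ι).topologicalClosure)
    {c₁ c₂ : G.graph.C} (hc : c₁ ≠ c₂) (V : Subgroup P) [V.Normal] (hVo : IsOpen (V : Set P)) :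
    ∃ U : Subgroup P, IsOpen (U : Set P) ∧ U ≤ V ∧ (U.subgroupOf V).Normal ∧
      G.cuspGp c₂ ⊓ V ≤ U ∧ ¬ (G.cuspGp c₁ ⊓ V ≤ U) := by
  simpa only [one_smul] using
    G.exists_edgeSeparating_of_smoothCurve hne hprime h ι hι e hC V hVo c₁ c₂ 1 1 (Or.inl hc)

/-- **Row F-2829 `SeparatingCoverings` at genuine smooth-curve data** (one vertex with `Π_v = Π`, no nodes,
cusp groups the closed cusp inertia groups): the verticial and `Π^unr`-verticial conjuncts hold because
every level has one vertex (`PSCSeparatingCoveringsSmoothProper`), the edge-like conjunct by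
`edgeLikeSeparatingCoverings_of_smoothCurve`. [cite: MochizukiCombGC2007, Prop 1.2 proof p.9] -/
theorem separatingCoverings_of_smoothCurve (hne : Sigma.Nonempty) (hprime : ∀ p ∈ Sigma, p.Prime)
    (h : IsHyperbolicType g r) (ι : PuncturedSurfaceGroup g r →* P) (hι : IsProSigmaCompletion Sigma ι)
    (G : PSCDatum P) (e : G.graph.C ≃ Fin r)
    (hC : ∀ c, G.cuspGp c = ((cuspInertia (g := g) (e c)).map ι).topologicalClosure) [IsEmpty G.graph.N]
    (hV : ∀ v, G.vertGp v = ⊤) (v₀ : G.graph.V) (hv : ∀ w, w = v₀) : G.SeparatingCoverings :=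
  ⟨G.verticialSeparatingCoverings_of_vertGp_eq_top hV v₀ hv,
    G.edgeLikeSeparatingCoverings_of_smoothCurve hne hprime h ι hι e hC,
    G.unrVerticialSeparatingCoverings_of_vertGp_eq_top hV v₀ hv⟩

end SmoothCurve

/-! ### Origin level -/

section Origin

variable (Ω : PSCOrigin.{u})

/-- **Row F-2830 `SeparatingCoveringsHolds Ω` at every origin all of whose data are of smooth-curve shape**
over profinite pro-`Σ` completions of hyperbolic punctured surface groups (the hypothesis shape of
`PSCSmoothCurveShape.commensurableTerminalityHolds_of_smoothCurve`).
[cite: MochizukiCombGC2007, Prop 1.2 proof p.9] -/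
theorem separatingCoveringsHolds_of_smoothCurve
    (hΩ : ∀ ⦃Q : Type u⦄ [Group Q] [TopologicalSpace Q] [IsTopologicalGroup Q] (G : PSCDatum Q),
      Ω.IsOfPSCType G → CompactSpace Q ∧ T2Space Q ∧ TotallyDisconnectedSpace Q ∧ IsEmpty G.graph.N ∧
        (∀ v, G.vertGp v = ⊤) ∧ (∃ v₀ : G.graph.V, ∀ w, w = v₀) ∧
        ∃ (S : Set ℕ) (g r : ℕ) (ι : PuncturedSurfaceGroup g r →* Q) (e : G.graph.C ≃ Fin r),
          S.Nonempty ∧ (∀ p ∈ S, p.Prime) ∧ IsHyperbolicType g r ∧ IsProSigmaCompletion S ι ∧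
          ∀ c, G.cuspGp c = ((cuspInertia (g := g) (e c)).map ι).topologicalClosure) :
    SeparatingCoveringsHolds Ω := by
  intro Q _ _ _ G hG
  obtain ⟨_, _, _, _, hV, ⟨v₀, hv⟩, S, g, r, ι, e, hne, hprime, h, hι, hC⟩ := hΩ G hG
  exact G.separatingCoverings_of_smoothCurve hne hprime h ι hι e hC hV v₀ hv

end Origin

end PSCDatum

end Literature.AnabelianGeometry.SemiGraphs

end
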